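import Summits.QuantumFields.YangMills.Theorems.IsotropyFromPowerCountingTemperedCurvatureMomentsDegreeTwo

/-!
# Three-point kernel of `TemperedCurvatureMoments`, part 2: lattice frames, mirror geometry, spans

Support file for stub `stub_threePointKernel` of reshape 4 of
`Cruxes/TemperedCurvatureMoments/Lines/Sketch.lean` (crux stmt-QuantumFields-17721, line `Sketch`).
Elementary geometry of the sixteen lattice mirrors of `ℝ⁴` used to turn the chart bounds of stub B into
the slot bounds of stub C at an injective triple:

* the axis and diagonal time directions `±e_μ`, `(±e_μ ± e_ν)/√2` are unit vectors;
* a ball `B(y, ρ)` lies in the slab `|⟪x - y, n⟫| < ρ` of a unit normal `n`; hence a slot isolated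
  `c·r` above the other two in direction `n` is separated from them by a mirror with gap `s/2`, and an
  `n`-separated pair is `n`-ordered, as soon as the factor supports have radius `s/8`, `s ≤ c·r`;
* the direction families of a good slot span `ℝ⁴`, and two spanning slots together with the diagonal
  translations span `(ℝ⁴)³`;
* the bookkeeping inequality turning `C (2/s)ᵖ · B₀ (8/s)^q (1 + ‖y‖)^q` into T's weight.
[folklore]
-/

noncomputable section

namespace Summit.QuantumFields.YangMills.Theorems.TemperedCurvatureMoments.Sketch

open scoped BigOperators SchwartzMap
open MeasureTheory Filter Topology Set Metric
open Literature.MathematicalPhysics.QuantumFieldTheory Literature.MathematicalPhysics.QuantumLattice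
open Literature.MathematicalPhysics.AQFT
open Summit.QuantumFields.YangMills.Theorems.NPointIsotropy.Negative (E4)

namespace ThreePointKernel

/-! ## Unit frame vectors -/

/-- The coordinate vectors of `ℝ⁴` are orthonormal: `⟪e_μ, e_ν⟫ = δ_{μν}`. [folklore] -/
theorem inner_single_single (μ ν : Fin 4) :
    inner ℝ (EuclideanSpace.single μ (1 : ℝ) : E4) (EuclideanSpace.single ν (1 : ℝ) : E4) =
      if μ = ν then 1 else 0 := by
  have h := (EuclideanSpace.basisFun (Fin 4) ℝ).orthonormal
  rw [orthonormal_iff_ite] at h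
  simpa only [EuclideanSpace.basisFun_apply] using h μ ν

/-- A vector of unit self-inner-product is a unit vector. [folklore] -/
theorem norm_eq_one_of_inner_self {v : E4} (h : inner ℝ v v = 1) : ‖v‖ = 1 := by
  have h2 : ‖v‖ ^ 2 = 1 ^ 2 := by rw [← real_inner_self_eq_norm_sq, one_pow]; exact h
  exact (sq_eq_sq₀ (norm_nonneg v) zero_le_one).1 h2

/-- Axis time directions `±e_μ` are unit vectors. [folklore] -/
theorem norm_axis_eq_one (μ : Fin 4) {s : ℝ} (hs : s = 1 ∨ s = -1) :
    ‖s • (EuclideanSpace.single μ (1 : ℝ) : E4)‖ = 1 := by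
  refine norm_eq_one_of_inner_self ?_
  have hss : s * s = 1 := by rcases hs with h | h <;> rw [h] <;> norm_num
  rw [real_inner_smul_left, real_inner_smul_right, inner_single_single, if_pos rfl, ← mul_assoc, hss, one_mul]

/-- Diagonal time directions `(±e_μ ± e_ν)/√2` (`μ ≠ ν`) and their in-plane partners are unit
vectors. [folklore] -/
theorem norm_diag_eq_one {μ ν : Fin 4} (hμν : μ ≠ ν) {s s' : ℝ} (hs : s = 1 ∨ s = -1) (hs' : s' = 1 ∨ s' = -1) :
    ‖(Real.sqrt 2)⁻¹ • (s • (EuclideanSpace.single μ (1 : ℝ) : E4) + s' • (EuclideanSpace.single ν (1 : ℝ) : E4))‖ = 1 ∧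
    ‖(Real.sqrt 2)⁻¹ • (s • (EuclideanSpace.single μ (1 : ℝ) : E4) - s' • (EuclideanSpace.single ν (1 : ℝ) : E4))‖ = 1 := by
  have hss : s * s = 1 := by rcases hs with h | h <;> rw [h] <;> norm_num
  have hss' : s' * s' = 1 := by rcases hs' with h | h <;> rw [h] <;> norm_num
  have h2 : (Real.sqrt 2)⁻¹ * (Real.sqrt 2)⁻¹ = 2⁻¹ := by
    rw [← mul_inv, Real.mul_self_sqrt zero_le_two]
  constructor
  · refine norm_eq_one_of_inner_self ?_
    simp only [real_inner_smul_left, real_inner_smul_right, inner_add_left, inner_add_right,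
      inner_single_single, if_true, if_neg hμν, if_neg (Ne.symm hμν)]
    calc _ = (Real.sqrt 2)⁻¹ * (Real.sqrt 2)⁻¹ * (s * s + s' * s') := by ring
      _ = 1 := by rw [h2, hss, hss']; norm_num
  · refine norm_eq_one_of_inner_self ?_
    simp only [real_inner_smul_left, real_inner_smul_right, inner_sub_left, inner_sub_right,
      inner_single_single, if_true, if_neg hμν, if_neg (Ne.symm hμν)]
    calc _ = (Real.sqrt 2)⁻¹ * (Real.sqrt 2)⁻¹ * (s * s + s' * s') := by ring
      _ = 1 := by rw [h2, hss, hss']; norm_num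

/-! ## Balls and half-spaces -/

/-- A ball lies in the slab of its centre: `|⟪x - y, n⟫| < ρ` on `B(y, ρ)` for a unit `n`. [folklore] -/
theorem inner_bounds_of_mem_ball {n : E4} (hn : ‖n‖ = 1) {x y : E4} {ρ : ℝ} (hx : x ∈ ball y ρ) :
    inner ℝ x n < inner ℝ y n + ρ ∧ inner ℝ y n - ρ < inner ℝ x n := by
  rw [mem_ball, dist_eq_norm] at hx
  have h : |inner ℝ (x - y) n| ≤ ‖x - y‖ := by
    have := abs_real_inner_le_norm (x - y) n
    rwa [hn, mul_one] at this
  rw [inner_sub_left] at h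
  obtain ⟨h1, h2⟩ := abs_le.1 h
  constructor <;> linarith

/-- **The mirror of an isolated slot.** If slot `k` lies `c·r` above the others in the unit direction
`n`, `0 < s ≤ c·r`, and the factors are supported in `B(yᵢ, s/8)`, then with the mirror level
`c₀ = ⟪y_k, n⟫ - c·r + s/8` the other factors are supported below the mirror and the `k`-th factor
beyond the gap `s/2`. [folklore] -/
theorem supports_of_gap {n : E4} (hn : ‖n‖ = 1) {y : Fin 3 → E4} {k : Fin 3} {c r s : ℝ}
    (hgap : ∀ i, i ≠ k → inner ℝ (y i) n + c * r ≤ inner ℝ (y k) n) (hs : 0 < s) (hsr : s ≤ c * r)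
    {f : Fin 3 → 𝓢(E4, ℂ)} (hf : ∀ i, tsupport (f i : E4 → ℂ) ⊆ ball (y i) (s / 8)) :
    (∀ i, i ≠ k → tsupport (f i : E4 → ℂ) ⊆ {x : E4 | inner ℝ x n < inner ℝ (y k) n - c * r + s / 8}) ∧
    tsupport (f k : E4 → ℂ) ⊆ {x : E4 | (inner ℝ (y k) n - c * r + s / 8) + s / 2 < inner ℝ x n} := by
  constructor
  · intro i hi x hx
    have h := (inner_bounds_of_mem_ball hn (hf i hx)).1
    have h' := hgap i hi
    show inner ℝ x n < _
    linarith
  · intro x hx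
    have h := (inner_bounds_of_mem_ball hn (hf k hx)).2
    show _ < inner ℝ x n
    linarith

/-- **An `n`-separated pair is `n`-ordered.** If `c·r ≤ |⟪y_i - y_{i'}, n⟫|`, `0 < s ≤ c·r`, and the
factors are supported in `B(y_j, s/8)`, then some level `c'` separates the supports of the `i`-th and
`i'`-th factors in direction `n`. [folklore] -/
theorem ordered_of_separated {n : E4} (hn : ‖n‖ = 1) {y : Fin 3 → E4} {i i' : Fin 3} {c r s : ℝ}
    (hsep : c * r ≤ |inner ℝ (y i) n - inner ℝ (y i') n|) (hs : 0 < s) (hsr : s ≤ c * r)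
    {f : Fin 3 → 𝓢(E4, ℂ)} (hf : ∀ i, tsupport (f i : E4 → ℂ) ⊆ ball (y i) (s / 8)) :
    ∃ c' : ℝ, (tsupport (f i : E4 → ℂ) ⊆ {x : E4 | inner ℝ x n < c'} ∧
        tsupport (f i' : E4 → ℂ) ⊆ {x : E4 | c' < inner ℝ x n}) ∨
      (tsupport (f i' : E4 → ℂ) ⊆ {x : E4 | inner ℝ x n < c'} ∧
        tsupport (f i : E4 → ℂ) ⊆ {x : E4 | c' < inner ℝ x n}) := by
  rcases le_or_gt (inner ℝ (y i) n) (inner ℝ (y i') n) with hle | hlt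
  · rw [abs_of_nonpos (by linarith)] at hsep
    refine ⟨inner ℝ (y i) n + c * r / 2, Or.inl ⟨fun x hx => ?_, fun x hx => ?_⟩⟩
    · have h := (inner_bounds_of_mem_ball hn (hf i hx)).1
      show inner ℝ x n < _
      linarith
    · have h := (inner_bounds_of_mem_ball hn (hf i' hx)).2
      show _ < inner ℝ x n
      linarith
  · rw [abs_of_pos (by linarith)] at hsep
    refine ⟨inner ℝ (y i') n + c * r / 2, Or.inr ⟨fun x hx => ?_, fun x hx => ?_⟩⟩
    · have h := (inner_bounds_of_mem_ball hn (hf i' hx)).1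
      show inner ℝ x n < _
      linarith
    · have h := (inner_bounds_of_mem_ball hn (hf i hx)).2
      show _ < inner ℝ x n
      linarith

/-- Separation in direction `±e_μ` is separation in direction `e_μ`. [folklore] -/
theorem abs_inner_sign_smul_sub {s₀ : ℝ} (hs : s₀ = 1 ∨ s₀ = -1) (a b v : E4) :
    |inner ℝ a (s₀ • v) - inner ℝ b (s₀ • v)| = |inner ℝ a v - inner ℝ b v| := by
  rw [real_inner_smul_right, real_inner_smul_right, ← mul_sub, abs_mul]
  rcases hs with h | h <;> simp [h]

/-- Balls of radius `s/8` about `s`-separated centres are disjoint, and so are supports inside them. [folklore] -/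
theorem disjoint_tsupport_of_ball {y : Fin 3 → E4} {i i' : Fin 3} {s : ℝ} (hs : s ≤ dist (y i) (y i'))
    (hs0 : 0 < s) {f : Fin 3 → 𝓢(E4, ℂ)} (hf : ∀ i, tsupport (f i : E4 → ℂ) ⊆ ball (y i) (s / 8)) :
    Disjoint (tsupport (f i : E4 → ℂ)) (tsupport (f i' : E4 → ℂ)) :=
  (ball_disjoint_ball (by linarith)).mono (hf i) (hf i')

/-! ## Spans -/

/-- **The axis direction family spans `ℝ⁴`**: `{s e_μ} ∪ {e_ν : ν ≠ μ}` (`s = ±1`). [folklore] -/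
theorem top_le_span_axisDirs (μ : Fin 4) {s₀ : ℝ} (hs : s₀ = 1 ∨ s₀ = -1) :
    ⊤ ≤ Submodule.span ℝ ((Finset.image (fun ν : Fin 4 => if ν = μ then s₀ • (EuclideanSpace.single μ (1 : ℝ) : E4)
      else (EuclideanSpace.single ν (1 : ℝ) : E4)) Finset.univ : Finset E4) : Set E4) := by
  set D : Finset E4 := Finset.image (fun ν : Fin 4 => if ν = μ then s₀ • (EuclideanSpace.single μ (1 : ℝ) : E4)
      else (EuclideanSpace.single ν (1 : ℝ) : E4)) Finset.univ with hD
  have hmem : ∀ ν : Fin 4, (if ν = μ then s₀ • (EuclideanSpace.single μ (1 : ℝ) : E4)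
      else (EuclideanSpace.single ν (1 : ℝ) : E4)) ∈ (D : Set E4) := fun ν => by
    rw [Finset.mem_coe, hD, Finset.mem_image]
    exact ⟨ν, Finset.mem_univ ν, rfl⟩
  have hb : ∀ ν : Fin 4, (EuclideanSpace.single ν (1 : ℝ) : E4) ∈ Submodule.span ℝ (D : Set E4) := by
    intro ν
    by_cases hν : ν = μ
    · subst hν
      have h1 : s₀ • (EuclideanSpace.single ν (1 : ℝ) : E4) ∈ Submodule.span ℝ (D : Set E4) := by
        have h := hmem ν
        rw [if_pos rfl] at h
        exact Submodule.subset_span h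
      have h2 : (EuclideanSpace.single ν (1 : ℝ) : E4) = s₀ • (s₀ • (EuclideanSpace.single ν (1 : ℝ) : E4)) := by
        rw [smul_smul]
        rcases hs with h | h <;> rw [h] <;> norm_num
      rw [h2]
      exact Submodule.smul_mem _ _ h1
    · have h := hmem ν
      rw [if_neg hν] at h
      exact Submodule.subset_span h
  intro u _
  rw [← (EuclideanSpace.basisFun (Fin 4) ℝ).sum_repr u]
  refine Submodule.sum_mem _ fun ν _ => Submodule.smul_mem _ _ ?_
  rw [EuclideanSpace.basisFun_apply]
  exact hb ν

/-- **Four linearly independent directions span `ℝ⁴`.** [folklore] -/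
theorem top_le_span_image_of_linearIndependent {t : Fin 4 → E4} (ht : LinearIndependent ℝ t) :
    ⊤ ≤ Submodule.span ℝ ((Finset.image t Finset.univ : Finset E4) : Set E4) := by
  rw [Finset.coe_image, Finset.coe_univ, Set.image_univ,
    ht.span_eq_top_of_card_eq_finrank' (by rw [Fintype.card_fin, finrank_euclideanSpace_fin])]

/-- The third slot: for `k₁ ≠ k₂` in `Fin 3` there is exactly one further index. [folklore] -/
theorem exists_third_slot (k₁ k₂ : Fin 3) (hk : k₁ ≠ k₂) :
    ∃ k₃ : Fin 3, k₃ ≠ k₁ ∧ k₃ ≠ k₂ ∧ ∀ k : Fin 3, k ≠ k₁ → k ≠ k₂ → k = k₃ := by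
  revert k₁ k₂
  decide

/-- **Two spanning slots and the diagonal translations span `(ℝ⁴)³`.** If the direction families of two
distinct slots `k₁ ≠ k₂` each span `ℝ⁴`, then the slot vectors `t ⊗ 1_k` (`t ∈ D k`) together with the
diagonal translations `e_μ ⊗ 1_{[3]}` span `(ℝ⁴)³` (the third slot is a translation minus the two
others). [folklore] -/
theorem top_le_span_slots (D : Fin 3 → Finset E4) {k₁ k₂ : Fin 3} (hk : k₁ ≠ k₂)
    (h₁ : ⊤ ≤ Submodule.span ℝ (D k₁ : Set E4)) (h₂ : ⊤ ≤ Submodule.span ℝ (D k₂ : Set E4)) :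
    ⊤ ≤ Submodule.span ℝ ((⋃ k : Fin 3, (fun t : E4 => (Pi.single k t : Fin 3 → E4)) '' (D k : Set E4)) ∪
          Set.range (fun μ : Fin 4 => fun _ : Fin 3 => (EuclideanSpace.single μ (1 : ℝ) : E4))) := by
  set V : Submodule ℝ (Fin 3 → E4) := Submodule.span ℝ ((⋃ k : Fin 3, (fun t : E4 => (Pi.single k t : Fin 3 → E4)) '' (D k : Set E4)) ∪
          Set.range (fun μ : Fin 4 => fun _ : Fin 3 => (EuclideanSpace.single μ (1 : ℝ) : E4))) with hV
  -- the two good slots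
  have hgood : ∀ k : Fin 3, ⊤ ≤ Submodule.span ℝ (D k : Set E4) → ∀ u : E4, (Pi.single k u : Fin 3 → E4) ∈ V := by
    intro k hk u
    have hu : u ∈ Submodule.span ℝ (D k : Set E4) := hk Submodule.mem_top
    have hle : Submodule.span ℝ (D k : Set E4) ≤ V.comap (LinearMap.single ℝ (fun _ : Fin 3 => E4) k) := by
      rw [Submodule.span_le]
      intro t ht
      simp only [SetLike.mem_coe, Submodule.mem_comap, LinearMap.coe_single]
      exact Submodule.subset_span (Or.inl (mem_iUnion.2 ⟨k, t, ht, rfl⟩))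
    simpa only [Submodule.mem_comap, LinearMap.coe_single] using hle hu
  -- the diagonal translations
  have hdiag : ∀ u : E4, (fun _ : Fin 3 => u) ∈ V := by
    intro u
    have hle : (⊤ : Submodule ℝ E4) ≤ V.comap (LinearMap.pi fun _ : Fin 3 => (LinearMap.id : E4 →ₗ[ℝ] E4)) := by
      intro w _
      rw [← (EuclideanSpace.basisFun (Fin 4) ℝ).sum_repr w]
      refine Submodule.sum_mem _ fun μ _ => Submodule.smul_mem _ _ ?_
      rw [Submodule.mem_comap, EuclideanSpace.basisFun_apply]
      have h : (LinearMap.pi fun _ : Fin 3 => (LinearMap.id : E4 →ₗ[ℝ] E4)) (EuclideanSpace.single μ (1 : ℝ)) =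
          fun _ : Fin 3 => (EuclideanSpace.single μ (1 : ℝ) : E4) := by
        funext i
        rw [LinearMap.pi_apply, LinearMap.id_apply]
      rw [h]
      exact Submodule.subset_span (Or.inr ⟨μ, rfl⟩)
    have h := hle (Submodule.mem_top (x := u))
    rw [Submodule.mem_comap] at h
    have h' : (LinearMap.pi fun _ : Fin 3 => (LinearMap.id : E4 →ₗ[ℝ] E4)) u = fun _ : Fin 3 => u := by
      funext i
      rw [LinearMap.pi_apply, LinearMap.id_apply]
    rwa [h'] at h
  -- the third slot
  obtain ⟨k₃, -, -, huniq⟩ := exists_third_slot k₁ k₂ hk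
  intro z _
  have hz : z = (fun _ : Fin 3 => z k₃) + (z - fun _ : Fin 3 => z k₃) := by abel
  rw [hz]
  refine V.add_mem (hdiag _) ?_
  set w : Fin 3 → E4 := z - fun _ : Fin 3 => z k₃ with hw
  rw [← Finset.univ_sum_single w]
  refine Submodule.sum_mem _ fun k _ => ?_
  by_cases hk1 : k = k₁
  · subst hk1; exact hgood _ h₁ _
  by_cases hk2 : k = k₂
  · subst hk2; exact hgood _ h₂ _
  have hk3 : k = k₃ := huniq k hk1 hk2
  subst hk3
  have h0 : w k = 0 := by simp [hw]
  rw [h0, Pi.single_zero]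
  exact V.zero_mem

/-! ## Bookkeeping for the weight -/

/-- The inverse distance of one pair is dominated by T's pair sum. [folklore] -/
theorem inv_norm_sub_le_pairSum (y : Fin 3 → E4) {i j : Fin 3} (hij : i ≠ j) :
    ‖y i - y j‖⁻¹ ≤ ∑ a, ∑ b ∈ Finset.univ.erase a, ‖y a - y b‖⁻¹ := by
  -- adapted from `DegreeTwoModelBlind.norm_kernel_le_pairWeight` (…TemperedCurvatureMomentsDegreeTwo)
  have h3 : ‖y i - y j‖⁻¹ ≤ ∑ b ∈ Finset.univ.erase i, ‖y i - y b‖⁻¹ :=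
    Finset.single_le_sum (f := fun b => ‖y i - y b‖⁻¹) (fun b _ => inv_nonneg.2 (norm_nonneg _))
      (Finset.mem_erase.2 ⟨hij.symm, Finset.mem_univ j⟩)
  have h4 : ∑ b ∈ Finset.univ.erase i, ‖y i - y b‖⁻¹ ≤ ∑ a, ∑ b ∈ Finset.univ.erase a, ‖y a - y b‖⁻¹ :=
    Finset.single_le_sum (f := fun a => ∑ b ∈ Finset.univ.erase a, ‖y a - y b‖⁻¹)
      (fun a _ => Finset.sum_nonneg fun b _ => inv_nonneg.2 (norm_nonneg _)) (Finset.mem_univ i)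
  exact h3.trans h4

/-- **The scale of the local chart against the pair sum.** With `s = min 1 (min (c·r) m)`, `0 < m ≤ r`
and `m⁻¹ ≤ σ`: `s⁻¹ ≤ (1 + (min c 1)⁻¹)(1 + σ)`. [folklore] -/
theorem inv_scale_le {c r m σ : ℝ} (hc : 0 < c) (hm : 0 < m) (hmr : m ≤ r) (hσ : 0 ≤ σ) (hmσ : m⁻¹ ≤ σ) :
    (min 1 (min (c * r) m))⁻¹ ≤ (1 + (min c 1)⁻¹) * (1 + σ) := by
  set c₁ : ℝ := min c 1 with hc₁
  have hc₁0 : 0 < c₁ := lt_min hc one_pos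
  have hc₁c : c₁ ≤ c := min_le_left _ _
  have hc₁1 : c₁ ≤ 1 := min_le_right _ _
  have hcm : 0 < c₁ * m := mul_pos hc₁0 hm
  have hs' : 0 < min 1 (c₁ * m) := lt_min one_pos hcm
  have hle : min 1 (c₁ * m) ≤ min 1 (min (c * r) m) := by
    refine min_le_min le_rfl (le_min ?_ ?_)
    · calc c₁ * m ≤ c * m := mul_le_mul_of_nonneg_right hc₁c hm.le
        _ ≤ c * r := mul_le_mul_of_nonneg_left hmr hc.le
    · calc c₁ * m ≤ 1 * m := mul_le_mul_of_nonneg_right hc₁1 hm.le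
        _ = m := one_mul m
  have h1 : (min 1 (min (c * r) m))⁻¹ ≤ (min 1 (c₁ * m))⁻¹ := inv_anti₀ hs' hle
  have h2 : (min 1 (c₁ * m))⁻¹ ≤ 1 + (c₁ * m)⁻¹ := by
    rcases min_choice (1 : ℝ) (c₁ * m) with h | h <;> rw [h]
    · rw [inv_one]; linarith [inv_nonneg.2 hcm.le]
    · linarith
  have h3 : (c₁ * m)⁻¹ ≤ c₁⁻¹ * σ := by
    rw [mul_inv]
    exact mul_le_mul_of_nonneg_left hmσ (inv_nonneg.2 hc₁0.le)
  have h4 : 1 + c₁⁻¹ * σ ≤ (1 + c₁⁻¹) * (1 + σ) := by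
    have := inv_nonneg.2 hc₁0.le
    nlinarith
  linarith

/-- **The local kernel bound against T's weight.** If `s⁻¹ ≤ a (1 + σ)` then
`C (1/(s/2))ᵖ · (B₀ (s/8)^{-q} Y^q) ≤ (C |B₀| 2ᵖ 8^q a^{p+q} + 1) Y^{p+q} (1 + σ)^{p+q}` for `Y ≥ 1`.
[folklore] -/
theorem local_bound_le_weight {C B₀ a σ Y s : ℝ} {p q : ℕ} (hC : 0 ≤ C) (ha : 0 ≤ a) (hσ : 0 ≤ σ)
    (hY : 1 ≤ Y) (hs : 0 < s) (hinv : s⁻¹ ≤ a * (1 + σ)) :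
    C * (1 / (s / 2)) ^ p * (B₀ * (s / 8)⁻¹ ^ q * Y ^ q) ≤
      (C * |B₀| * 2 ^ p * 8 ^ q * a ^ (p + q) + 1) * Y ^ (p + q) * (1 + σ) ^ (p + q) := by
  set X : ℝ := a * (1 + σ) with hX
  have hX0 : 0 ≤ X := by positivity
  have hs2 : 1 / (s / 2) = 2 * s⁻¹ := by rw [one_div, inv_div]; ring
  have hs8 : (s / 8)⁻¹ = 8 * s⁻¹ := by rw [inv_div]; ring
  have h2 : 1 / (s / 2) ≤ 2 * X := by rw [hs2]; linarith
  have h8 : (s / 8)⁻¹ ≤ 8 * X := by rw [hs8]; linarith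
  have h20 : 0 ≤ 1 / (s / 2) := by positivity
  have h80 : 0 ≤ (s / 8)⁻¹ := by positivity
  have hY0 : 0 ≤ Y := zero_le_one.trans hY
  have hYq : Y ^ q ≤ Y ^ (p + q) := pow_le_pow_right₀ hY (Nat.le_add_left q p)
  have hS1 : 1 ≤ (1 + σ) ^ (p + q) := one_le_pow₀ (by linarith)
  calc C * (1 / (s / 2)) ^ p * (B₀ * (s / 8)⁻¹ ^ q * Y ^ q)
      ≤ C * (1 / (s / 2)) ^ p * (|B₀| * (s / 8)⁻¹ ^ q * Y ^ q) := by
        refine mul_le_mul_of_nonneg_left ?_ (by positivity)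
        exact mul_le_mul_of_nonneg_right (mul_le_mul_of_nonneg_right (le_abs_self B₀) (by positivity)) (by positivity)
    _ ≤ C * (2 * X) ^ p * (|B₀| * (8 * X) ^ q * Y ^ (p + q)) := by gcongr
    _ = (C * |B₀| * 2 ^ p * 8 ^ q * a ^ (p + q)) * Y ^ (p + q) * (1 + σ) ^ (p + q) := by
        rw [hX, mul_pow, mul_pow, mul_pow, mul_pow, pow_add, pow_add]; ring
    _ ≤ (C * |B₀| * 2 ^ p * 8 ^ q * a ^ (p + q) + 1) * Y ^ (p + q) * (1 + σ) ^ (p + q) := by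
        gcongr
        linarith

end ThreePointKernel

end Summit.QuantumFields.YangMills.Theorems.TemperedCurvatureMoments.Sketch

end
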